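/-
Copyright (c) 2026 the pub-hodgecm-mathlib formalisation cell (harness21).  Prover seat hodgecm-mathlib-R90-C10-p08 (g2), SLAB R90-TF, section S1 «Ch. 10∕12 local»;
crux H413 = `stmt-HodgeConjecture-24833`; line (D-1) «B_pos at inert places» of U4Keys :182 (S1 A2′), card (B-2b″) = R90-C10-plan (g2) UN-CROSS 2026-09-04T23:40:20Z (i) +
R-S1-16 (5) (memo `R90/R90-C10-p05/g2/DESIGN-Bpos-inert.md` f70d293d60bf8a4b §2 (E5), §5).  KERNEL module: THEOREMS ONLY (no definition, no named fact, no `sorry`, no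
instance, no notation).  2026-09-05.
-/
import Summits.HodgeConjecture.HodgeConjecture.Theorems.R90S1BposCellCoverTwoDepthCM             -- ★ p863167 (R90-C10-p05 (g2)) (B-2b′): `cover_cells_twoDepth_CM`, `shellWitness_family` at a GENERAL two-depth group `J_e`, `e = (r₁, s₁; r₂, s₂)`, letters `(m, k, t, u₁, u₂)`; brings the (G3) frame and ★ p862990
import Summits.HodgeConjecture.HodgeConjecture.Theorems.K2E3KeysThmTwoDepthZeroBranchBConstants   -- ★ (K2E3-p32): `norm_apply_uniformizer_lt_one` (`|χ₁(ϖ̂)| < 1` for a contracting `χ₁`, `v` unramified); brings ★ `NonsplitPlaceHaarBallRatios` (`isUnit_toLocalRing_uniformizer`, `conjLocal_toLocalRing_uniformizer`, `valued_toLocalRing_uniformizer_apply`)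
import Literature.NumberTheory.Rogawski1990.RankOneUnstableDeltaValueInert                        -- ★ `exists_add_galAdicCompletionMap_eq_one` (a trace-one `t ∈ 𝒪_w`, `t + σ_w t = 1`, at a place unramified in `L`)
import HarnessLib

/-!
# R90-TF S1 «Ch10-local» ∕ K2 E3 «U4Keys» :182, BRANCH B AT POSITIVE DEPTH — brick (B-2b″): THE CELL LETTERS `hcells`, `hwit` OF ★ (B-0) AT THE LINE'S FRAME
# `e = (r₁, 0; r₂, 1)`, `k = 0`, WITH THE TRACE-ONE AND THE F-WITNESS LETTERS DISCHARGED — the consumer surface of the leaf (B-7)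
# [Rogawski1990 §1.10, §12.1–§12.2; Casselman1995 Prop. 1.3.1, §6.3; Roche1998 §3–§4; BruhatTits1972 (4.4.4), (6.4.9); Serre1979 Ch. V §2]

Cell `pub/hodgecm-mathlib`, crux H413 = `stmt-HodgeConjecture-24833`, route of record `HCCMUnconditional` (no route verbs); R90-TF section S1 (junction socket A2′
`stub_R90_122_keysThmTwo_ramifiedCharOne` = U4Keys :217, REL over :155 (★-closable) and :182 (OPEN)).  THEOREMS ONLY; lane `--supports stmt-HodgeConjecture-24833 --as helper`,
count-neutral.  NOT THE PAYER of :182: consumed BY NAME by the leaf (B-7) `R90S1KeysThmTwoPosDepthBranchBInertLeaf` (head FROZEN d21b054346b3bcdc) when it feeds ★ (B-0)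
`R90S1BranchBDeterminantVanishingCells.det_intertwiningIntegral_eq_zero_of_typeVector_of_cells`.
WHAT.  ★ (B-2b′) p863167 (R90-C10-p05 (g2)) exports the two letters of ★ (B-0) at a GENERAL two-depth group `J_e`, `e = (r₁, s₁; r₂, s₂)`, over ★ p862990's letters `(m, k)`, a
trace-one `t`, the E-witness `u₁` and a `σ`-fixed F-witness `u₂` at depth `k`.  The line (D-1) «B_pos at an INERT place» runs at Roche's group with `(s₁, s₂) = (0, 1)` and `k = 0`
(memo §1: `e = (⌊n∕2⌋, 0; ⌈n∕2⌉, 1)`, `n = m + 1 = cond_E χ₁`), where two of those letters are NOT letters of the leaf: this file DISCHARGES them —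
the trace-one `t` by ★ `exists_add_galAdicCompletionMap_eq_one` (`v` unramified in `L`: the trace `𝒪_w → 𝒪_v` is onto), and the F-witness by the `k = 0` TRICK of memo §2 (E5),
`u₂ := ι_v ϖ_v` (★ `isUnit_toLocalRing_uniformizer`; `σ`-fixed ★ `conjLocal_toLocalRing_uniformizer`; `|(ι_vϖ_v)_{w′} − 1|_{w′} ≤ 1 = |ϖ|⁰` ★ `valued_toLocalRing_uniformizer_apply`;
`χ₁(ι_vϖ_v) ≠ 1` because `|χ₁(ι_vϖ_v)| < 1`, ★ `norm_apply_uniformizer_lt_one` from `hcontr`) — and discharges the exponent side conditions `hkm hss hr1 hs1 hs2 hal h10 h20` from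
`r₁ + r₂ = m + 1`, `r₁ ≤ r₂ ≤ r₁ + 1` (memo §1: Roche concavity forces `(r₁, r₂) = (⌊n∕2⌋, ⌈n∕2⌉)`).  The exported statements are in ★ (B-0)'s EXACT binder shapes on the carrier
`G = U(Φ₃)(L⁺_v)` (`H := (cmBorelTriple L 3 v).P`, `B := J_e`, `g₀ := w₀`, `θ := dite χ₁ (·)₀₀`, `τ :=` the record's `δ^{1∕2}·(χ₁, 1)`-line), with the representative family `R`
HYPOTHESIS-FIRST (letter `hR` = ★ p863167's set read on `U(Φ₃)(L⁺_v)`), so the leaf passes them with `exact` (no `show`, no carrier coercion on its side).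
* §1 **`cells_cover_kZero`** — the letter `hcells` (frame only).
* §2 **`cells_witness_kZero`** — the letter `hwit` from EXACTLY the leaf's letters: `hunr`, `χ₁`, `hcontr`, the conductor letter `hcond` at `m + 1`, the E-witness `u₁` at depth `m`
  (★ `K2E3LocalCharacterConductorLetters.exists_conductor_letters` supplies `m`, `hcond`, `u₁` from `h₁ ∧ hpos`), and the exponents `(hm : 1 ≤ m) (hrr : r₁ + r₂ = m + 1)
  (hr12 : r₁ ≤ r₂) (hr21 : r₂ ≤ r₁ + 1)`.
(R90-C10-p01 (g2)'s ★ p863109 `exists_depth_witness_twoDepth_kZero` is the model-level alternative for the lower shells without any F-witness; not needed on this road.)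
HONEST LABEL.  HC_CM is proved only modulo the 7 printed citations (2 remaining named inputs: hLiu418 = `stmt-HodgeConjecture-24832`, h413 = `stmt-HodgeConjecture-24833`) until rung 0
closes; count-neutral — this file pays NO socket (:182 and A2′ stay OPEN until (B-7) lands and the dealer ties :217); no printed citation is discharged.

## References
* [Rogawski1990] J. D. Rogawski, *Automorphic Representations of Unitary Groups in Three Variables*, Ann. of Math. Stud. 123 (1990), §1.10 p. 9; §12.1 p. 171; §12.2 (1)–(2) p. 173.
* [Casselman1995] W. Casselman, *Introduction to the theory of admissible representations of `p`-adic reductive groups* (1995), Prop. 1.3.1, §6.3.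
* [Roche1998] A. Roche, *Types and Hecke algebras for principal series representations of split reductive p-adic groups*, Ann. Sci. ÉNS (4) 31 (1998), §3–§4.
* [BruhatTits1972] F. Bruhat, J. Tits, *Groupes réductifs sur un corps local I*, Publ. Math. IHÉS 41 (1972), (4.4.4), (6.4.9).
* [Serre1979] J.-P. Serre, *Local Fields*, GTM 67 (1979), Ch. V §2 Prop. 3 (surjectivity of the trace on integers in the unramified case).
* [Keys1984] D. Keys, *Principal series representations of special unitary groups over local fields*, Compositio Math. 51 (1984), §7 Theorem (2) p. 126.
-/

set_option autoImplicit false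
-- the mandated namespace has the single-problem summit's repeated segment (`HodgeConjecture.HodgeConjecture`)
set_option linter.dupNamespace false

noncomputable section

open NumberField IsDedekindDomain
open scoped Matrix MatrixGroups WithZero Valued
open Literature.NumberTheory Literature.NumberTheory.Automorphic Literature.NumberTheory.Automorphic.UnitaryGroup
open Literature.NumberTheory.Rogawski1990

namespace Summit.HodgeConjecture.HodgeConjecture.R90.S1.BposCellCoverTwoDepthKZeroCM

open Summit.HodgeConjecture.HodgeConjecture.Cruxes.H413
open Summit.HodgeConjecture.HodgeConjecture.R90.S1

variable (L : Type) [Field L] [NumberField L] [IsCMField L] (v : HeightOneSpectrum (𝓞 ↥(maximalRealSubfield L)))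
  (w : PlacesOver L v) (hw : IsCMField.complexConj L • w.1 = w.1)
  (eA : Gqs L v ≃ₜ* ↥(unitaryGroupOfForm (galAdicCompletionMap (L := L) (IsCMField.complexConj L) hw) ((StdForm.antidiagonal 3).over (w.1.adicCompletion L))))
  (heA : ∀ g : Gqs L v,
    ((eA g : ↥(unitaryGroupOfForm (galAdicCompletionMap (L := L) (IsCMField.complexConj L) hw) ((StdForm.antidiagonal 3).over (w.1.adicCompletion L)))) :
        GL (Fin 3) (w.1.adicCompletion L)) =
      ((localNonsplitEquiv (IsCMField.complexConj L) (qsForm L) (IsCMField.complexConj_ne_one L) w hw g :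
        ↥(unitaryGroupOfForm (galAdicCompletionMap (L := L) (IsCMField.complexConj L) hw) (placeForm (qsForm L) w.1))) : GL (Fin 3) (w.1.adicCompletion L)))
  {ϖ : w.1.adicCompletion L} (hϖ : Valued.v ϖ = WithZero.exp (-1 : ℤ))
  (r₁ r₂ : ℕ) (Jg : Subgroup ↥(unitaryGroupOfForm (galAdicCompletionMap (L := L) (IsCMField.complexConj L) hw) ((StdForm.antidiagonal 3).over (w.1.adicCompletion L))))
  (hJg : ∀ k : ↥(unitaryGroupOfForm (galAdicCompletionMap (L := L) (IsCMField.complexConj L) hw) ((StdForm.antidiagonal 3).over (w.1.adicCompletion L))),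
    k ∈ Jg ↔ ∀ i j, Valued.v (((k : GL (Fin 3) (w.1.adicCompletion L)) : Matrix (Fin 3) (Fin 3) (w.1.adicCompletion L)) i j) ≤
      Valued.v ϖ ^ (![![0, r₁, 0], ![r₂, 0, r₁], ![1, r₂, 0]] : Fin 3 → Fin 3 → ℕ) i j)
  (Je : Subgroup (Gqs L v)) (hJe : Je = Jg.comap eA.toMulEquiv.toMonoidHom)
  (w₀ : ↥(unitaryGroupOfForm (conjLocal L (IsCMField.complexConj L) v) (cmLocalForm L 3 v))) (hw₀ : Units.val (w₀ : GL (Fin 3) (LocalRing L v)) = cmLocalForm L 3 v)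
  (R : Set ↥(unitaryGroupOfForm (conjLocal L (IsCMField.complexConj L) v) (cmLocalForm L 3 v)))
  (hR : ∀ r : ↥(unitaryGroupOfForm (conjLocal L (IsCMField.complexConj L) v) (cmLocalForm L 3 v)), r ∈ R ↔
    r ∈ ((cmBorelTriple L 3 v).N).map (MulAut.conj w₀).toMonoidHom ∧ r ∉ Je ∧
      ¬ (Valued.v ((((eA r : ↥(unitaryGroupOfForm (galAdicCompletionMap (L := L) (IsCMField.complexConj L) hw) ((StdForm.antidiagonal 3).over (w.1.adicCompletion L)))) : GL (Fin 3) (w.1.adicCompletion L)) : Matrix (Fin 3) (Fin 3) (w.1.adicCompletion L)) 2 1 /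
            (((eA r : ↥(unitaryGroupOfForm (galAdicCompletionMap (L := L) (IsCMField.complexConj L) hw) ((StdForm.antidiagonal 3).over (w.1.adicCompletion L)))) : GL (Fin 3) (w.1.adicCompletion L)) : Matrix (Fin 3) (Fin 3) (w.1.adicCompletion L)) 2 0) ≤ Valued.v ϖ ^ r₁ ∧
          (Valued.v ϖ ^ 0)⁻¹ ≤ Valued.v ((((eA r : ↥(unitaryGroupOfForm (galAdicCompletionMap (L := L) (IsCMField.complexConj L) hw) ((StdForm.antidiagonal 3).over (w.1.adicCompletion L)))) : GL (Fin 3) (w.1.adicCompletion L)) : Matrix (Fin 3) (Fin 3) (w.1.adicCompletion L)) 2 0)))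

/-! ## §1 The letter `hcells` at `e = (r₁, 0; r₂, 1)` -/

include hw heA hϖ hJg hJe hw₀ hR in
set_option maxHeartbeats 800000 in
-- the two definitionally equal carriers `Gqs L v` (★ p863167's letters) ∕ `U(Φ₃)(L⁺_v)` (this statement) meet only through `exact` (typist rule of record, K2E3-plan ROUND 4b)
/-- **THE LETTER `hcells` OF ★ (B-0) AT ROCHE's GROUP `J_e`, `e = (r₁, 0; r₂, 1)`, on `U(Φ₃)(L⁺_v)`.**  With the representative family `R` of `hR` (shells `r ∈ N̄(L⁺_v) = N.map (conj w₀)`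
off `J_e` and off the sharp big cell `|(eA r)₂₁∕(eA r)₂₀| ≤ |ϖ|^{r₁} ∧ |(eA r)₂₀| ≥ 1`): every `y ∈ U(Φ₃)(L⁺_v)` is `h·b`, or `h·w₀·b`, or `h·r·b` with `h ∈ P`, `b ∈ J_e`, `r ∈ R`
— ★ p863167 `cover_cells_twoDepth_CM` at `(s₁, s₂) := (0, 1)`, re-read in ★ (B-0)'s binder shape (no character, no conductor letter).
[cite: Rogawski1990, §1.10 p. 9] [cite: Casselman1995, Prop. 1.3.1] [cite: BruhatTits1972, (4.4.4), (6.4.9)] [cite: Roche1998, §3–§4] -/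
theorem cells_cover_kZero :
    ∀ y : ↥(unitaryGroupOfForm (conjLocal L (IsCMField.complexConj L) v) (cmLocalForm L 3 v)),
      (∃ h ∈ (cmBorelTriple L 3 v).P, ∃ b : ↥(unitaryGroupOfForm (conjLocal L (IsCMField.complexConj L) v) (cmLocalForm L 3 v)), b ∈ Je ∧ y = h * b) ∨
      (∃ h ∈ (cmBorelTriple L 3 v).P, ∃ b : ↥(unitaryGroupOfForm (conjLocal L (IsCMField.complexConj L) v) (cmLocalForm L 3 v)), b ∈ Je ∧ y = h * w₀ * b) ∨
      ∃ r ∈ R, ∃ h ∈ (cmBorelTriple L 3 v).P, ∃ b : ↥(unitaryGroupOfForm (conjLocal L (IsCMField.complexConj L) v) (cmLocalForm L 3 v)), b ∈ Je ∧ y = h * r * b := by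
  intro y
  rcases BposCellCoverTwoDepthCM.cover_cells_twoDepth_CM L v w hw eA heA hϖ r₁ 0 r₂ 1 Jg hJg Je hJe w₀ hw₀ (cmBorelTriple L 3 v) rfl y with
    ⟨h, hh, b, hb, e⟩ | ⟨h, hh, b, hb, e⟩ | ⟨r, ⟨hrN, hoff, hshal⟩, h, hh, b, hb, e⟩
  · exact Or.inl ⟨h, hh, b, hb, e⟩
  · exact Or.inr (Or.inl ⟨h, hh, b, hb, e⟩)
  · exact Or.inr (Or.inr ⟨r, (hR r).2 ⟨hrN, hoff, hshal⟩, h, hh, b, hb, e⟩)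

/-! ## §2 The letter `hwit` at `e = (r₁, 0; r₂, 1)`, `k = 0` — trace-one and F-witness discharged -/

open Classical in
include hw heA hϖ hJg hJe hw₀ hR in
set_option maxHeartbeats 1600000 in
set_option synthInstance.maxHeartbeats 400000 in
-- class of ★ p862990 ∕ ★ p863167 (1600000): the `U(Φ₃)(L⁺_v)`-valued products are read in two definitionally equal carriers; unification is slow
/-- **THE LETTER `hwit` OF ★ (B-0) AT `e = (r₁, 0; r₂, 1)`, `k = 0`, FROM THE LEAF's LETTERS.**  `v` non-split and UNRAMIFIED in `L` (`hunr`); `χ₁ : (L ⊗ L⁺_v)ˣ → ℂˣ` contracting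
(`hcontr`) with conductor letter `hcond` at `m + 1` (`χ₁ = 1` on `{∀ w′, |u_{w′} − 1| ≤ |ϖ|^{m+1}}`, `1 ≤ m`) and E-witness `u₁` (`|(u₁)_{w′} − 1| ≤ |ϖ|ᵐ`, `χ₁ u₁ ≠ 1`); exponents
`r₁ + r₂ = m + 1`, `r₁ ≤ r₂ ≤ r₁ + 1`.  Then every `r ∈ R` is `θ`-IRRELEVANT: there is `b₀ ∈ J_e` with `r b₀ r⁻¹ ∈ P` and `θ(b₀) ≠ τ(r b₀ r⁻¹)·1`
(`θ(g) = if IsUnit g₀₀ then χ₁(unit g₀₀) else 0`, `τ = ((1 ⊗ (χ₁, 1)) ∘ proj) ⊗ δ^{1∕2}`).  Proof: ★ p863167 `shellWitness_family` at `(s₁, s₂, k) := (0, 1, 0)` with `t` from ★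
`exists_add_galAdicCompletionMap_eq_one` and `u₂ := ι_v ϖ_v` (`σ`-fixed, integral, `χ₁(ι_vϖ_v) ≠ 1` by ★ `norm_apply_uniformizer_lt_one`); `hr1 hs1 hs2 hal h10 h20` by arithmetic.
[cite: Roche1998, §3–§4] [cite: Casselman1995, §6.3] [cite: Rogawski1990, §12.1 p. 171, §12.2 (1)–(2) p. 173] [cite: BruhatTits1972, (6.4.9)] [cite: Serre1979, Ch. V §2 Prop. 3]
[cite: Keys1984, §7 Theorem (2) p. 126] -/
theorem cells_witness_kZero {m : ℕ} (hm : 1 ≤ m) (hrr : r₁ + r₂ = m + 1) (hr12 : r₁ ≤ r₂) (hr21 : r₂ ≤ r₁ + 1)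
    (hunr : Algebra.IsUnramifiedIn (𝓞 L) v.asIdeal)
    (χ₁ : (LocalRing L v)ˣ →* ℂˣ)
    (hcontr : ∀ x : (LocalRing L v)ˣ, unitModulusChar (LocalRing L v) x < 1 → ‖((χ₁ x : ℂˣ) : ℂ)‖ < 1)
    (hcond : ∀ u : (LocalRing L v)ˣ, (∀ w' : PlacesOver L v, Valued.v (((u : LocalRing L v) w') - 1) ≤ Valued.v ϖ ^ (m + 1)) → χ₁ u = 1)
    (u₁ : (LocalRing L v)ˣ) (hu₁ : ∀ w' : PlacesOver L v, Valued.v (((u₁ : LocalRing L v) w') - 1) ≤ Valued.v ϖ ^ m) (hχu₁ : χ₁ u₁ ≠ 1) :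
    ∀ r ∈ R, ∃ b₀ : ↥(unitaryGroupOfForm (conjLocal L (IsCMField.complexConj L) v) (cmLocalForm L 3 v)), b₀ ∈ Je ∧ ∃ hb₀P : r * b₀ * r⁻¹ ∈ (cmBorelTriple L 3 v).P,
      (if h : IsUnit (((b₀ : GL (Fin 3) (LocalRing L v)) : Matrix (Fin 3) (Fin 3) (LocalRing L v)) 0 0) then ((χ₁ h.unit : ℂˣ) : ℂ) else 0) ≠
        (haveI := locallyCompactSpace_cmBorelU L 3 v
         (Representation.twist
            (((Representation.trivial ℂ ↥(torusU (conjLocal L (IsCMField.complexConj L) v) (cmLocalForm L 3 v)) ℂ).twist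
              (cmTorusCharPair L v χ₁ 1)).comp (cmBorelTriple L 3 v).proj) (rootDeltaChar (cmBorelTriple L 3 v).P))
          ⟨r * b₀ * r⁻¹, hb₀P⟩ 1) := by
  intro r hr
  haveI := locallyCompactSpace_cmBorelU L 3 v
  obtain ⟨hrN, hoff, hshal⟩ := (hR r).1 hr
  -- the trace-one letter (`v` unramified: `Tr 𝒪_w = 𝒪_v`)
  obtain ⟨t, hvt, ht⟩ := exists_add_galAdicCompletionMap_eq_one L v w hw hunr
  -- the F-witness at depth `k = 0`: `u₂ := ι_v ϖ_v`
  have hσϖ : Units.map (conjLocal L (IsCMField.complexConj L) v : LocalRing L v →* LocalRing L v) (isUnit_toLocalRing_uniformizer L v).unit =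
      (isUnit_toLocalRing_uniformizer L v).unit :=
    Units.ext (by rw [Units.coe_map, MonoidHom.coe_coe]; exact conjLocal_toLocalRing_uniformizer L v)
  have hϖ0 : ∀ w' : PlacesOver L v, Valued.v ((((isUnit_toLocalRing_uniformizer L v).unit : (LocalRing L v)ˣ) : LocalRing L v) w' - 1) ≤ Valued.v ϖ ^ 0 := fun w' => by
    rw [pow_zero]
    refine (Valuation.map_sub _ _ _).trans (max_le ?_ (by rw [Valuation.map_one]))
    rw [valued_toLocalRing_uniformizer_apply L v w' hunr, ← WithZero.exp_zero, WithZero.exp_le_exp]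
    norm_num
  have hχϖ : χ₁ (isUnit_toLocalRing_uniformizer L v).unit ≠ 1 := fun h1 => by
    have hlt := K2E3KeysThmTwoDepthZeroBranchBConstants.norm_apply_uniformizer_lt_one L v w hw hunr χ₁ hcontr
    rw [h1, Units.val_one, norm_one] at hlt
    exact lt_irrefl _ hlt
  -- ★ p863167 at `(s₁, s₂, k) := (0, 1, 0)`, read back on the carrier `U(Φ₃)(L⁺_v)`
  obtain ⟨b₀, hb₀J, hb₀P, hne⟩ := BposCellCoverTwoDepthCM.shellWitness_family L v w hw eA heA hϖ r₁ 0 r₂ 1 Jg hJg Je hJe w₀ hw₀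
    hm (Nat.zero_le m) hrr rfl (by omega) hr21 (by omega) (by omega) (Or.inl ⟨hr12, Nat.zero_le 1⟩) (by omega) le_rfl ht hvt χ₁ hcond u₁ hu₁ hχu₁
    (isUnit_toLocalRing_uniformizer L v).unit hσϖ hϖ0 hχϖ r ⟨hrN, hoff, hshal⟩
  exact ⟨b₀, hb₀J, hb₀P, hne⟩

end Summit.HodgeConjecture.HodgeConjecture.R90.S1.BposCellCoverTwoDepthKZeroCM

end
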